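import Literature.AlgebraicGeometry.Resolution.RankOneReductionProofs
import Mathlib.RingTheory.DiscreteValuationRing.Basic
import Mathlib.Algebra.Polynomial.Identities
import Mathlib.FieldTheory.Separable
import Mathlib.RingTheory.Polynomial.Tower
import Mathlib.RingTheory.Adjoin.Polynomial.Basic
import Mathlib.FieldTheory.IntermediateField.Adjoin.Algebra
import HarnessLib

/-!
# Discrete places with finite separable residue field extension admit relative local uniformization (Knaf–Kuhlmann 2009, Thm. 1.5)

Topic: `Literature/AlgebraicGeometry/Resolution`. Sources (statement level):

* H. Knaf, F.-V. Kuhlmann, *Every place admits local uniformization in a finite extension of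
  the function field*, Adv. Math. 221 (2009) 428–453 = arXiv:math/0702856, **Thm. 1.5**
  (numbering of the arXiv version, label `MTdens`, proved in §3.4): "Let `(F|K,P)` be a valued
  function field with the property that `(F,P)` lies in the completion of a subfunction field
  `(F₀,P|F₀)` such that `P|F₀` is an Abhyankar place of `F₀|K`, `vF₀/vK` is torsion-free and
  `F₀P|KP` is separable. If `P|K = id_K`, then `P` is strongly smoothly `K`-uniformizable …".
  We record it (NAMED FACT `KnafKuhlmann2009MonogenicCompletion`, unproved here) for the
  sub-function fields `F₀ = K(y)` generated by ONE element `y ∈ O_P` whose residue is a root of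
  a separable polynomial over `K` (then `P|K(y)` is non-trivial — or `K(y)/K` is finite
  separable and everything is trivial —, of transcendence degree `1` = rational rank `1`, i.e.
  Abhyankar, with residue field `K(ȳ)` separable over `K`; `vK = 0`), the completion
  hypothesis being rendered as DENSITY of `K(y)` in `F` for the valuation: for every `a ∈ F`
  and every value `γ` there is `b ∈ K(y)` with `v(a - b) < γ`. "Strongly smoothly
  `K`-uniformizable" implies `RelLocalUniformization` exactly as explained in
  `RationalDiscreteLocalUniformization.lean` (a faithful weakening).
* F.-V. Kuhlmann, *On local uniformization in arbitrary characteristic I*, arXiv:math/9903097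
  (1999), Remark 1 after Thm. 1.12 (the rational discrete case: `F₀ = K(x)`, `x` of smallest
  positive value, `F ⊆ K((x))`), of which the following is the evident generalisation.

PROVED here [folklore; elementary]: let `O ⊇ k` be a valuation ring of `K` which is a DISCRETE
VALUATION RING whose residue field is generated over `k` by the residue `ȳ` of one element
`y ∈ O` that is a root of a SEPARABLE polynomial `μ ∈ k[X]` (equivalently: the residue field
extension `κ(O)/k` is finite separable, `ȳ` a primitive element). Then the hypotheses of the
fact hold for `y' = y` or `y' = y + ϖ` (`ϖ` a uniformizer): `μ'(y)` is a unit (separability),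
so by the Taylor expansion `μ(y + ϖ) = μ(y) + μ'(y)ϖ + rϖ²` one of `μ(y)`, `μ(y + ϖ)` is a
uniformizer `ϖ' ∈ k[y']` (`exists_uniformizer_aeval`); and successive `ϖ'`-adic approximation
with "digits" `Pᵢ(y') ∈ k[y']` shows that `k(y')` is dense in `K` (`isDenseOver_of_uniformizer`).
Hence (`relLocalUniformization_of_isDiscreteWithSeparableResidue`) such `O` admit relative
local uniformization, granted the fact; and, combined with Novacoski–Spivakovsky 2014 Thm. 1.1
(tree theorem `NovacoskiSpivakovsky2014_holds`), relative local uniformization over `k`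
reduces to the RANK-ONE valuation rings over `k` which are NOT discrete with finite separable
residue field extension (`relLocalUniformization_iff_rankOne_nonDiscreteSeparable`). The
rational case (`κ(O) = k`: `y = ϖ`, `μ = X`) is `isDiscreteWithSeparableResidue_of_rational`.

Use: this removes from the open core of local uniformization in positive characteristic every
discrete valuation ring whose residue field is finite separable over the ground field (the
"arcs through separable closed points"), in every dimension.
-/

noncomputable section

namespace Literature.AlgebraicGeometry.Resolution

open Polynomial IsLocalRing

variable {k K : Type} [Field k] [Field K] [Algebra k K]

/-! ## Definitions -/

/-- `(K, v_O)` lies in the completion of `(k(y), v_O|k(y))`: the subfield `k(y)` is DENSE in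
`K` for the valuation of `O` — every element of `K` is approximated by elements of `k(y)` to
within every value. [cite: KnafKuhlmann2009, Thm. 1.5] -/
def IsDenseOver (k : Type) {K : Type} [Field k] [Field K] [Algebra k K]
    (O : ValuationSubring K) (y : K) : Prop :=
  ∀ a : K, ∀ γ : O.ValueGroup, γ ≠ 0 →
    ∃ b ∈ IntermediateField.adjoin k ({y} : Set K), O.valuation (a - b) < γ

/-- The residue of `y` is a root of a SEPARABLE polynomial over `k` (so it is separable
algebraic over `k`; as a separable polynomial is non-zero this also makes the valuation
non-trivial on `k(y)` unless `y` is itself algebraic over `k`). [folklore] -/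
def HasSeparableResidue (k : Type) {K : Type} [Field k] [Field K] [Algebra k K]
    (O : ValuationSubring K) (y : K) : Prop :=
  ∃ μ : k[X], μ.Separable ∧ O.valuation (aeval y μ) < 1

/-- The residue field of `O` is generated over `k` by the residue of `y`: every element of `O`
is congruent to a polynomial in `y` with coefficients in `k` modulo the maximal ideal.
[folklore] -/
def IsResiduallyGeneratedBy (k : Type) {K : Type} [Field k] [Field K] [Algebra k K]
    (O : ValuationSubring K) (y : K) : Prop :=
  ∀ t ∈ O, ∃ P : k[X], O.valuation (t - aeval y P) < 1

/-- `O` is a DISCRETE valuation ring whose residue field is a FINITE SEPARABLE extension of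
`k`, witnessed by a generator: some `y ∈ O` whose residue is a root of a separable polynomial
over `k` and generates the residue field over `k`. [folklore] -/
def IsDiscreteWithSeparableResidue (k : Type) {K : Type} [Field k] [Field K] [Algebra k K]
    (O : ValuationSubring K) : Prop :=
  IsDiscreteValuationRing O ∧
    ∃ y ∈ O, HasSeparableResidue k O y ∧ IsResiduallyGeneratedBy k O y

/-- NAMED FACT — **Knaf–Kuhlmann 2009, Thm. 1.5** for monogenic Abhyankar subfields, in the
language of this topic: let `K/k` be finitely generated, `O ⊇ k` a valuation ring of `K`,
`y ∈ O` an element whose residue is a root of a separable polynomial over `k`, and suppose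
`k(y)` is dense in `K` for the valuation of `O` ("`(K,P)` lies in the completion of
`(k(y),P)`"). Then every affine model of `K` inside `O` is dominated by an affine model inside
`O` that is regular at the centre of `O` (`P` is strongly smoothly `k`-uniformizable). Any
characteristic, any transcendence degree. Users take `(h : KnafKuhlmann2009MonogenicCompletion)`.
[cite: KnafKuhlmann2009, Thm. 1.5] -/
def KnafKuhlmann2009MonogenicCompletion : Prop :=
  ∀ (k K : Type) [Field k] [Field K] [Algebra k K], (⊤ : IntermediateField k K).FG →
    ∀ O : ValuationSubring K, (∀ c : k, algebraMap k K c ∈ O) →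
      ∀ y : K, y ∈ O → HasSeparableResidue k O y → IsDenseOver k O y →
        RelLocalUniformization k K O

/-! ## Elementary lemmas -/

/-- Polynomials in an element of `O` with coefficients in `k ⊆ O` lie in `O` (local copy of a
folklore lemma of `ResidueFieldRepresentatives.lean`, stated for `Algebra k K`). [folklore] -/
private theorem aeval_mem_valuationSubring' (O : ValuationSubring K)
    (hk : ∀ c : k, algebraMap k K c ∈ O) {y : K} (hy : y ∈ O) (P : k[X]) : aeval y P ∈ O := by
  induction P using Polynomial.induction_on with
  | C c => simpa using hk c
  | add p q hp hq => simpa using add_mem hp hq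
  | monomial n c _ =>
    simpa [map_mul, aeval_C, aeval_X_pow] using mul_mem (hk c) (pow_mem hy (n + 1))

/-- Polynomials in `y` lie in `k(y)`. [folklore] -/
theorem aeval_mem_adjoin_simple (y : K) (P : k[X]) :
    aeval y P ∈ IntermediateField.adjoin k ({y} : Set K) :=
  IntermediateField.algebra_adjoin_le_adjoin k _
    (Polynomial.aeval_mem_adjoin_singleton (R := k) (x := y) (p := P))

/-- In a local ring, a unit plus an element of the maximal ideal is a unit (local copy of the
folklore lemma of `WeightedInitialTerms.lean`, to keep imports minimal). [folklore] -/
private theorem isUnit_add_of_mem_maximalIdeal' {R : Type*} [CommRing R] [IsLocalRing R] {u m : R}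
    (hu : IsUnit u) (hm : m ∈ maximalIdeal R) : IsUnit (u + m) := by
  by_contra h
  have h' : u + m ∈ maximalIdeal R := (IsLocalRing.mem_maximalIdeal _).mpr h
  have hu' : u ∈ maximalIdeal R := by simpa using Ideal.sub_mem _ h' hm
  exact (IsLocalRing.mem_maximalIdeal _).mp hu' hu

/-- If `μ` is separable and `μ(y)` lies in the maximal ideal of a local `k`-algebra, then
`μ'(y)` is a unit (Bézout relation `aμ + bμ' = 1` evaluated at `y`). [folklore] -/
theorem isUnit_aeval_derivative {R : Type*} [CommRing R] [IsLocalRing R] [Algebra k R] (y : R)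
    {μ : k[X]} (hμ : μ.Separable) (hy : aeval y μ ∈ maximalIdeal R) :
    IsUnit (aeval y (derivative μ)) := by
  obtain ⟨a, b, hab⟩ := hμ
  have h1 : aeval y a * aeval y μ + aeval y b * aeval y (derivative μ) = 1 := by
    simpa [map_add, map_mul] using congrArg (aeval y) hab
  have h2 : IsUnit (aeval y b * aeval y (derivative μ)) := by
    have e : aeval y b * aeval y (derivative μ) = 1 - aeval y a * aeval y μ := by
      rw [← h1]; ring
    rw [e]
    exact IsLocalRing.isUnit_one_sub_self_of_mem_nonunits _ (Ideal.mul_mem_left _ _ hy)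
  exact isUnit_of_mul_isUnit_right h2

/-- **A uniformizer in `k[y']`.** In a discrete valuation ring `O` which is a `k`-algebra, if
`μ ∈ k[X]` is separable and `μ(y) ∈ 𝔪`, then for `y' = y` or `y' = y + ϖ` (so `y' ≡ y mod 𝔪`)
the element `μ(y')` is a uniformizer: by Taylor expansion `μ(y + ϖ) = μ(y) + μ'(y)ϖ + rϖ²`
with `μ'(y)` a unit, if `μ(y) ∈ 𝔪²` then `μ(y + ϖ) ∈ ϖ·Oˣ`. [folklore] -/
theorem exists_uniformizer_aeval (O : Type*) [CommRing O] [IsDomain O]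
    [IsDiscreteValuationRing O] [Algebra k O] (y : O) {μ : k[X]} (hμ : μ.Separable)
    (hy : aeval y μ ∈ maximalIdeal O) :
    ∃ y' : O, y' - y ∈ maximalIdeal O ∧ Irreducible (aeval y' μ) := by
  by_cases h0 : Irreducible (aeval y μ)
  · exact ⟨y, by simp, h0⟩
  obtain ⟨ϖ, hϖ⟩ := IsDiscreteValuationRing.exists_irreducible O
  have hϖm : ϖ ∈ maximalIdeal O := (IsLocalRing.mem_maximalIdeal _).mpr hϖ.not_isUnit
  have hd : IsUnit (aeval y (derivative μ)) := isUnit_aeval_derivative y hμ hy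
  have hmem : aeval y μ ∈ Ideal.span {ϖ} := hϖ.maximalIdeal_eq ▸ hy
  obtain ⟨c, hc⟩ := Ideal.mem_span_singleton'.mp hmem
  -- `c` is not a unit, for otherwise `μ(y) = cϖ` would be irreducible
  have hcm : c ∈ maximalIdeal O := by
    refine (IsLocalRing.mem_maximalIdeal _).mpr fun hcu => h0 ?_
    rw [← hc]
    obtain ⟨u, rfl⟩ := hcu
    exact (show Associated ϖ (↑u * ϖ) from ⟨u, mul_comm _ _⟩).irreducible hϖ
  obtain ⟨r, hr⟩ := Polynomial.binomExpansion (μ.map (algebraMap k O)) y ϖ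
  have e1 : aeval (y + ϖ) μ = aeval y μ + aeval y (derivative μ) * ϖ + r * ϖ ^ 2 := by
    simpa [Polynomial.eval_map_algebraMap, derivative_map] using hr
  obtain ⟨u, hu⟩ := isUnit_add_of_mem_maximalIdeal' hd
    (add_mem hcm (Ideal.mul_mem_left _ r hϖm))
  refine ⟨y + ϖ, by simpa using hϖm, ?_⟩
  have e2 : aeval (y + ϖ) μ = ϖ * ↑u := by
    rw [e1, ← hc, hu]; ring
  rw [e2]
  exact (show Associated ϖ (ϖ * ↑u) from ⟨u, rfl⟩).irreducible hϖ

/-- **Density.** If `O ⊇ k` is a discrete valuation ring of `K` whose residue field is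
generated over `k` by the residue of `y ∈ O`, and some uniformizer `ϖ` of `O` lies in `k(y)`,
then `k(y)` is dense in `K`: writing `a ∈ O` as `a = P₀(y) + ϖ a₁`, `a₁ = P₁(y) + ϖ a₂`, … gives
`v(a - Σ_{i<n} Pᵢ(y)ϖⁱ) ≤ v(ϖ)ⁿ`, and a general `a ∈ K` is `ϖ^{-m} a'` with `a' ∈ O`.
[folklore] [cite: Kuhlmann1999, Rem. 1 after Thm. 1.12] -/
theorem isDenseOver_of_uniformizer (O : ValuationSubring K) [IsDiscreteValuationRing O]
    (hk : ∀ c : k, algebraMap k K c ∈ O) {y : K} (hy : y ∈ O)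
    (hres : IsResiduallyGeneratedBy k O y) {ϖ : O} (hϖ : Irreducible ϖ)
    (hϖy : (ϖ : K) ∈ IntermediateField.adjoin k ({y} : Set K)) : IsDenseOver k O y := by
  classical
  have hϖm : ϖ ∈ maximalIdeal O := (IsLocalRing.mem_maximalIdeal _).mpr hϖ.not_isUnit
  have hvϖ : O.valuation (ϖ : K) < 1 := (O.valuation_lt_one_iff ϖ).mp hϖm
  have hϖ0 : (ϖ : K) ≠ 0 := fun h => hϖ.ne_zero (Subtype.ext h)
  have hvϖ0 : 0 < O.valuation (ϖ : K) :=
    zero_lt_iff.mpr ((Valuation.ne_zero_iff _).mpr hϖ0)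
  -- successive approximation inside `O`
  have stepA : ∀ n : ℕ, ∀ a : K, a ∈ O →
      ∃ b ∈ IntermediateField.adjoin k ({y} : Set K), ∃ c ∈ O, a - b = (ϖ : K) ^ n * c := by
    intro n
    induction n with
    | zero => intro a ha; exact ⟨0, zero_mem _, a, ha, by simp⟩
    | succ n ih =>
      intro a ha
      obtain ⟨b, hb, c, hc, e⟩ := ih a ha
      obtain ⟨P, hP⟩ := hres c hc
      have hPO : aeval y P ∈ O := aeval_mem_valuationSubring' O hk hy P
      have hm : (⟨c - aeval y P, sub_mem hc hPO⟩ : O) ∈ maximalIdeal O :=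
        (O.valuation_lt_one_iff _).mpr hP
      rw [hϖ.maximalIdeal_eq] at hm
      obtain ⟨s, hs⟩ := Ideal.mem_span_singleton'.mp hm
      have hs' : (s : K) * ϖ = c - aeval y P := by
        simpa using congrArg Subtype.val hs
      refine ⟨b + (ϖ : K) ^ n * aeval y P,
        add_mem hb (mul_mem (pow_mem hϖy n) (aeval_mem_adjoin_simple y P)), s, s.2, ?_⟩
      calc a - (b + (ϖ : K) ^ n * aeval y P) = (a - b) - (ϖ : K) ^ n * aeval y P := by ring
        _ = (ϖ : K) ^ n * (c - aeval y P) := by rw [e]; ring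
        _ = (ϖ : K) ^ (n + 1) * s := by rw [← hs']; ring
  -- every element of `K` becomes integral after multiplication by a power of `ϖ`
  have stepM : ∀ a : K, ∃ m : ℕ, a * (ϖ : K) ^ m ∈ O := by
    intro a
    rcases O.mem_or_inv_mem a with ha | ha
    · exact ⟨0, by simpa using ha⟩
    by_cases ha0 : a = 0
    · exact ⟨0, by simp [ha0, zero_mem]⟩
    have hne : (⟨a⁻¹, ha⟩ : O) ≠ 0 := by
      intro h
      have : a⁻¹ = 0 := by simpa using congrArg Subtype.val h
      exact ha0 (inv_eq_zero.mp this)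
    obtain ⟨m, u, hu⟩ := IsDiscreteValuationRing.eq_unit_mul_pow_irreducible hne hϖ
    have hu' : a⁻¹ = ((u : O) : K) * (ϖ : K) ^ m := by
      simpa using congrArg Subtype.val hu
    have hv : O.valuation a⁻¹ = O.valuation ((ϖ : K) ^ m) := by
      rw [hu', map_mul, O.valuation_unit u, one_mul]
    refine ⟨m, (O.valuation_le_one_iff _).mp (le_of_eq ?_)⟩
    rw [map_mul, ← hv, ← map_mul, mul_inv_cancel₀ ha0, map_one]
  -- some power of `v ϖ` lies below any prescribed non-zero value
  have stepN : ∀ x : K, x ≠ 0 → ∃ n : ℕ, O.valuation (ϖ : K) ^ n ≤ O.valuation x := by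
    intro x hx0
    rcases O.mem_or_inv_mem x with hxO | hxO
    · have hne : (⟨x, hxO⟩ : O) ≠ 0 := fun h => hx0 (by simpa using congrArg Subtype.val h)
      obtain ⟨n, u, hu⟩ := IsDiscreteValuationRing.eq_unit_mul_pow_irreducible hne hϖ
      refine ⟨n, le_of_eq ?_⟩
      have hu' : x = ((u : O) : K) * (ϖ : K) ^ n := by simpa using congrArg Subtype.val hu
      rw [hu', map_mul, map_pow, O.valuation_unit u, one_mul]
    · refine ⟨0, ?_⟩
      rw [pow_zero]
      have h1 : O.valuation x⁻¹ ≤ 1 := (O.valuation_le_one_iff _).mpr hxO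
      rw [map_inv₀] at h1
      exact (inv_le_one₀ (zero_lt_iff.mpr ((Valuation.ne_zero_iff _).mpr hx0))).mp h1
  -- conclusion
  intro a γ hγ
  obtain ⟨x, rfl⟩ := O.valuation_surjective γ
  have hx0 : x ≠ 0 := by rintro rfl; exact hγ (map_zero _)
  obtain ⟨n, hn⟩ := stepN x hx0
  obtain ⟨m, hm⟩ := stepM a
  obtain ⟨b', hb', c, hc, e⟩ := stepA (m + (n + 1)) (a * (ϖ : K) ^ m) hm
  have hϖm0 : (ϖ : K) ^ m ≠ 0 := pow_ne_zero _ hϖ0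
  refine ⟨b' / (ϖ : K) ^ m, div_mem hb' (pow_mem hϖy m), ?_⟩
  have e' : a - b' / (ϖ : K) ^ m = (ϖ : K) ^ (n + 1) * c := by
    have h1 : a - b' / (ϖ : K) ^ m = (a * (ϖ : K) ^ m - b') / (ϖ : K) ^ m := by
      field_simp
    rw [h1, e, pow_add, mul_assoc, mul_div_cancel_left₀ _ hϖm0]
  rw [e', map_mul, map_pow]
  calc O.valuation (ϖ : K) ^ (n + 1) * O.valuation c
      ≤ O.valuation (ϖ : K) ^ (n + 1) * 1 := by
        gcongr
        exact (O.valuation_le_one_iff c).mpr hc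
    _ = O.valuation (ϖ : K) ^ (n + 1) := mul_one _
    _ < O.valuation (ϖ : K) ^ n := pow_lt_pow_right_of_lt_one₀ hvϖ0 hvϖ (Nat.lt_succ_self n)
    _ ≤ O.valuation x := hn

/-! ## The reduction -/

/-- **Discrete valuation rings with finite separable residue field extension admit relative
local uniformization** (granted Knaf–Kuhlmann 2009 Thm. 1.5): replace the generator `y` by
`y' ≡ y` with `μ(y')` a uniformizer in `k[y']`; then `k(y')` is an Abhyankar subfield with the
same (separable) residue field in whose completion `K` lies.
[cite: KnafKuhlmann2009, Thm. 1.5] [folklore] -/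
theorem relLocalUniformization_of_isDiscreteWithSeparableResidue
    (hKK : KnafKuhlmann2009MonogenicCompletion) (hfg : (⊤ : IntermediateField k K).FG)
    (O : ValuationSubring K) (hk : ∀ c : k, algebraMap k K c ∈ O)
    (hO : IsDiscreteWithSeparableResidue k O) : RelLocalUniformization k K O := by
  classical
  obtain ⟨hdvr, y, hy, ⟨μ, hμ, hμy⟩, hres⟩ := hO
  let ι : k →+* O := (algebraMap k K).codRestrict O hk
  letI : Algebra k O := ι.toAlgebra
  haveI : IsScalarTower k O K := IsScalarTower.of_algebraMap_eq fun _ => rfl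
  have hcoe : ∀ (t : O) (P : k[X]), ((aeval t P : O) : K) = aeval (t : K) P := fun t P =>
    (Polynomial.aeval_algebraMap_apply K t P).symm
  have hyμ : aeval (⟨y, hy⟩ : O) μ ∈ maximalIdeal O := by
    rw [O.valuation_lt_one_iff, hcoe]; exact hμy
  obtain ⟨y', hy'y, hirr⟩ := exists_uniformizer_aeval O ⟨y, hy⟩ hμ hyμ
  -- the residue field is generated by `y'` as well
  have hres' : IsResiduallyGeneratedBy k O (y' : K) := by
    intro t ht
    obtain ⟨P, hP⟩ := hres t ht
    refine ⟨P, ?_⟩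
    have hd : O.valuation (aeval y P - aeval (y' : K) P) < 1 := by
      have hm : aeval (⟨y, hy⟩ : O) P - aeval y' P ∈ maximalIdeal O := by
        obtain ⟨q, hq⟩ := Polynomial.sub_dvd_eval_sub (⟨y, hy⟩ : O) y' (P.map (algebraMap k O))
        simp only [Polynomial.eval_map_algebraMap] at hq
        rw [hq]
        refine Ideal.mul_mem_right _ _ ?_
        simpa using (maximalIdeal O).neg_mem hy'y
      have := (O.valuation_lt_one_iff _).mp hm
      simpa [hcoe] using this
    have e : t - aeval (y' : K) P = (t - aeval y P) + (aeval y P - aeval (y' : K) P) := by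
      rw [sub_add_sub_cancel]
    rw [e]
    exact Valuation.map_add_lt _ hP hd
  have hsep' : HasSeparableResidue k O (y' : K) := by
    refine ⟨μ, hμ, ?_⟩
    rw [← hcoe]
    exact (O.valuation_lt_one_iff _).mp
      ((IsLocalRing.mem_maximalIdeal _).mpr hirr.not_isUnit)
  have hdense : IsDenseOver k O (y' : K) :=
    isDenseOver_of_uniformizer O hk y'.2 hres' hirr
      (by rw [hcoe]; exact aeval_mem_adjoin_simple _ μ)
  exact hKK k K hfg O hk y' y'.2 hsep' hdense

/-- The RATIONAL discrete case is an instance: if `O ⊇ k` is a discrete valuation ring every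
element of which is congruent to a constant of `k` modulo the maximal ideal, then `O` is
discrete with (finite) separable residue field extension — generator a uniformizer `ϖ`,
separable polynomial `X`. [folklore] [cite: Kuhlmann1999, Rem. 1 after Thm. 1.12] -/
theorem isDiscreteWithSeparableResidue_of_rational (O : ValuationSubring K)
    (hO : IsDiscreteValuationRing O)
    (hrat : ∀ t ∈ O, ∃ c : k, O.valuation (t - algebraMap k K c) < 1) :
    IsDiscreteWithSeparableResidue k O := by
  haveI := hO
  obtain ⟨ϖ, hϖ⟩ := IsDiscreteValuationRing.exists_irreducible O
  have hϖm : ϖ ∈ maximalIdeal O := (IsLocalRing.mem_maximalIdeal _).mpr hϖ.not_isUnit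
  refine ⟨hO, ϖ, ϖ.2, ⟨X, Polynomial.separable_X, ?_⟩, fun t ht => ?_⟩
  · simpa using (O.valuation_lt_one_iff ϖ).mp hϖm
  · obtain ⟨c, hc⟩ := hrat t ht
    exact ⟨C c, by simpa using hc⟩

/-- **Relative local uniformization over `k` reduces to the rank-one valuation rings that are
not discrete with finite separable residue field extension.** Granted Knaf–Kuhlmann 2009
Thm. 1.5: if relative local uniformization holds at every RANK-ONE valuation ring `O ⊇ k` of
every finitely generated `K/k` which is NOT a discrete valuation ring with residue field finite
separable over `k` (generated by the separable residue of an element), then it holds at every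
valuation ring over `k` (Novacoski–Spivakovsky 2014, Thm. 1.1 — tree theorem
`NovacoskiSpivakovsky2014_holds` — and a case distinction at rank one).
[cite: KnafKuhlmann2009, Thm. 1.5] [cite: NovacoskiSpivakovsky2014, Thm. 1.1] -/
theorem relLocalUniformization_of_rankOne_nonDiscreteSeparable
    (hKK : KnafKuhlmann2009MonogenicCompletion) {k : Type} [Field k]
    (H : ∀ (K : Type) [Field K] [Algebra k K], (⊤ : IntermediateField k K).FG →
      ∀ O : ValuationSubring K, Nonempty O.valuation.RankOne →
        (∀ c : k, algebraMap k K c ∈ O) → ¬ IsDiscreteWithSeparableResidue k O →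
          RelLocalUniformization k K O)
    (K : Type) [Field K] [Algebra k K] (O : ValuationSubring K) :
    RelLocalUniformization k K O := by
  classical
  refine NovacoskiSpivakovsky2014_holds k (fun K _ _ O hr => ?_) K O
  intro R hR hfrac hRO
  have hk : ∀ c : k, algebraMap k K c ∈ O := fun c => hRO (R.algebraMap_mem c)
  have hfg : (⊤ : IntermediateField k K).FG := by
    obtain ⟨s, hs⟩ := hR
    refine ⟨s, eq_top_iff.mpr fun x _ => ?_⟩
    haveI := hfrac
    obtain ⟨a, b, -, rfl⟩ := IsFractionRing.div_surjective (A := R) x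
    have hle : R ≤ (IntermediateField.adjoin k (s : Set K)).toSubalgebra := by
      rw [← hs]
      exact IntermediateField.algebra_adjoin_le_adjoin k _
    exact div_mem (hle a.2) (hle b.2)
  by_cases h : IsDiscreteWithSeparableResidue k O
  · exact relLocalUniformization_of_isDiscreteWithSeparableResidue hKK hfg O hk h R hR hfrac hRO
  · exact H K hfg O hr hk h R hR hfrac hRO

/-- **The equivalence.** Granted Knaf–Kuhlmann 2009 Thm. 1.5, relative local uniformization at
all valuation rings over `k` is EQUIVALENT to relative local uniformization at the rank-one
valuation rings over `k` (of finitely generated extensions, containing `k`) which are not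
discrete with finite separable residue field extension.
[cite: KnafKuhlmann2009, Thm. 1.5] [cite: NovacoskiSpivakovsky2014, Thm. 1.1] -/
theorem relLocalUniformization_iff_rankOne_nonDiscreteSeparable
    (hKK : KnafKuhlmann2009MonogenicCompletion) {k : Type} [Field k] :
    (∀ (K : Type) [Field K] [Algebra k K] (O : ValuationSubring K),
        RelLocalUniformization k K O) ↔
      ∀ (K : Type) [Field K] [Algebra k K], (⊤ : IntermediateField k K).FG →
        ∀ O : ValuationSubring K, Nonempty O.valuation.RankOne →
          (∀ c : k, algebraMap k K c ∈ O) →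
            ¬ IsDiscreteWithSeparableResidue k O → RelLocalUniformization k K O :=
  ⟨fun h K _ _ _ O _ _ _ => h K O,
    fun H K _ _ O => relLocalUniformization_of_rankOne_nonDiscreteSeparable hKK H K O⟩

end Literature.AlgebraicGeometry.Resolution

end
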